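import Literature.Probability.LatticeModels.AnnealedDeviceCorrMeasurable
import Summits.CriticalPhenomena.Ising3DConformalLimit.Theorems.ConformalPoissonDeviceDeviceWeylUniversalityStubDeviceOdd
import HarnessLib

/-!
# Route ConformalPoissonDevice · crux `DeviceWeylUniversality` (stmt-CriticalPhenomena-4722) ·
# line `birth` · stub D2 `stub_deviceMeasurable`

The quenched device Gibbs average `deviceGibbsAverage β n x` (free zero-field finite-volume Ising
average on the pencil-rule graph of the configuration, spins read at the chordal-nearest sites; the
integrand of `annealedDeviceCorr`) is a.e.-strongly measurable for the count σ-algebra under each of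
the route's Poisson laws `P N` (intensity `N(1+‖z‖²)⁻³ dz` on `ℝ³`): the instance, for a finite
intensity with a Lebesgue density, of the Literature theorem
`Literature.Probability.LatticeModels.aestronglyMeasurable_deviceGibbsAverage`
(`AnnealedDeviceCorrMeasurable.lean`: labelled coordinates + factorial measures + a.s. finiteness and
a.s. uniqueness of the chordal read-out). This closes the first formal prerequisite of the Weyl-law
stub W' (`stub_deviceWeylLawEven`): `annealedDeviceCorr (P N) β n x` is a genuine expectation.
-/

noncomputable section

open MeasureTheory Literature.Analysis.FunctionSpaces Literature.Probability.LatticeModels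

namespace Summit.CriticalPhenomena.Ising3DConformalLimit.Theorems.DeviceWeylUniversality

/-- **Stub D2 of line `birth` (crux stmt-CriticalPhenomena-4722)**: for the Poisson laws of intensity
`N(1+‖z‖²)⁻³ dz` on `ℝ³`, the quenched device Gibbs average is a.e.-strongly measurable, for every
coupling `β`, every `N`, `n` and marked points `x` (finite intensity `StubDeviceOdd.deviceOdd_isFiniteMeasure`,
density w.r.t. Lebesgue measure, `aestronglyMeasurable_deviceGibbsAverage`). [cite: LastPenrose2017, Thm 4.1] -/
theorem stub_deviceMeasurable :
    ∀ (P : ℕ → MeasureTheory.Measure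
      (Literature.Analysis.FunctionSpaces.PointConfig (EuclideanSpace ℝ (Fin 3)))),
    (∀ N : ℕ, Literature.Analysis.FunctionSpaces.IsPoissonPointProcess ((N : ENNReal) •
      (MeasureTheory.volume : MeasureTheory.Measure (EuclideanSpace ℝ (Fin 3))).withDensity
        (fun z => ENNReal.ofReal ((1 + ‖z‖ ^ 2) ^ (-(3:ℝ))))) (P N))
    → ∀ (β : ℝ) (N n : ℕ) (x : Fin n → EuclideanSpace ℝ (Fin 3)),
      MeasureTheory.AEStronglyMeasurable
        (Literature.Probability.LatticeModels.deviceGibbsAverage β n x) (P N) := by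
  intro P hP β N n x
  haveI := StubDeviceOdd.deviceOdd_isFiniteMeasure N
  exact aestronglyMeasurable_deviceGibbsAverage
    (Measure.smul_absolutelyContinuous.trans (withDensity_absolutelyContinuous _ _)) (hP N) β n x

end Summit.CriticalPhenomena.Ising3DConformalLimit.Theorems.DeviceWeylUniversality

end
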